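import Summits.QuantumFields.YangMills.Theorems.UnitScaleTiltProp7SymAvgTwDefs
import Summits.QuantumFields.YangMills.Theorems.UnitScaleTiltProp7LatticeBoxPoincareCov
import HarnessLib

/-!
# Route `UnitScaleTilt`, crux K1 (stmt-QuantumFields-19200), LANE II (QB) ∕ (R-LEGS): COUNTING ROW (L2) of ✓`rlegs_flat_Zd_of_counting` —
# every fine torus site lies in the torus images of at most `3(4L²+2)³` top boxes `box(ℓ·ŷ(c₋), 2L²ℓ)`, `c` a coarse bond
Cell `ym3-torus`, width seat `ym3-torus-px19` (gen 6; pen (R-LEGS)).  THEOREMS ONLY (0 `def`, 0 `sorry`); `--supports stmt-QuantumFields-19200 --as helper`, count-neutral.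
YM₃ on T³ is a ladder rung (R3), not d = 4, not Clay; nothing here claims a stub, the crux or the gap.  Pure lattice counting: if `transl x₀ z = x` with `|z − ℓŷ|_∞ ≤ R` then, per
coordinate, `ŷ_i ≡ t (mod N_k)` for an integer `t` with `|ℓt − x̃_i| ≤ R` (`x̃_i` the residue of `x_i − x₀_i`, `N_K = ℓN_k`), and there are at most `4L²+2` such `t`.
PROVED (ns `…Prop7CornerFrameLegsFlatCountL2`): ★`card_coarseBonds_covering_le` (= the displayed (L2) of F3c with `μ₂ L = 3(4L²+2)³`).
References: T. Bałaban, CMP 109 (1987) 249–301 [Balaban1987RG1] ((0.1) p.251); CMP 98 (1985) 17–51 [Balaban1985Averaging] ((110) p.34).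
-/

set_option autoImplicit false

noncomputable section

open scoped BigOperators Matrix.Norms.L2Operator
open Finset

namespace Summit.QuantumFields.YangMills.Theorems.Prop7CornerFrameLegsFlatCountL2

open Literature.MathematicalPhysics.QuantumFieldTheory.Balaban1983to89
open Literature.MathematicalPhysics.QuantumFieldTheory.Balaban1983to89.T3ContinuumYM3Torus
open Literature.MathematicalPhysics.QuantumFieldTheory.Balaban1983to89.B4Eq19LatticeOperators (Zd box unitVec mem_box)
open T3LevelShift (siteShift coordEquiv coordEquiv_val)
open T3PrintedRegularOrbits (sites_eq)
open B10Eq27TorusAxialLog (transl transl_apply)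
open Summit.QuantumFields.YangMills.Theorems.Prop7SPrint (basePt)
open Summit.QuantumFields.YangMills.Theorems.Prop7SymAvgTw (coordT3 coordT3_apply)

variable {F : T3Family} {n K : ℕ}

/-- `N_K = L^{K−n} · N_k` (`N_K = 2L^{m+K}`, `N_k = 2L^{m+n}`). [cite: Balaban1987RG1, (0.1) p.251] -/
theorem sitesPerDir_zero_eq_mul (h : n ≤ K) :
    (F.P K).sitesPerDir 0 = (F.P K).L ^ (K - n) * (F.PP F.m K).sitesPerDir (K - n) := by
  simp only [Params.sitesPerDir, T3Family.P_eq_PP, T3Family.PP_L, T3Family.PP_m, T3Family.PP_K, Nat.sub_zero]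
  have hm : K - n ≤ F.m + K := by omega
  have : F.L ^ (F.m + K) = F.L ^ (K - n) * F.L ^ (F.m + K - (K - n)) := by rw [← pow_add, Nat.add_sub_cancel' hm]
  rw [this]; ring

set_option maxHeartbeats 400000 in
-- HEARTBEAT rule (README): the covering argument manipulates `ZMod` residues at two levels under a triple product; measured > 200k; decl-local.
/-- ★ **(L2) THE COVERING MULTIPLICITY OF THE TOP BOXES** (`μ₂ L = 3(4L²+2)³`). [cite: Balaban1987RG1, (0.1) p.251; Balaban1985Averaging, (110) p.34] -/
theorem card_coarseBonds_covering_le (h : n ≤ K) (x : Site (F.P K) 0) :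
    ((Finset.univ.filter fun c : PBond (F.P n) 0 =>
        x ∈ (box (((((F.P K).L ^ (K - n) : ℕ) : ℤ)) • (fun i : Fin 3 => coordT3 F n K h c.src i)) (2 * (((F.P K).L ^ (K - n + 2) : ℕ) : ℤ))).image
              (fun z : Zd 3 => transl (basePt F n K) z)).card : ℝ)
      ≤ 3 * (4 * ((F.P K).L : ℝ) ^ 2 + 2) ^ 3 := by
  classical
  set ℓ : ℕ := (F.P K).L ^ (K - n) with hℓ
  set R : ℤ := 2 * (((F.P K).L ^ (K - n + 2) : ℕ) : ℤ) with hR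
  set NK : ℕ := (F.P K).sitesPerDir 0 with hNK
  set Nk : ℕ := (F.PP F.m K).sitesPerDir (K - n) with hNk
  have hL1 : 1 ≤ (F.P K).L := by have := F.hL.2; show 1 ≤ F.L; omega
  have hℓ0 : 0 < ℓ := pow_pos (by omega) _
  have hℓz : (0 : ℤ) < (ℓ : ℤ) := by exact_mod_cast hℓ0
  have hNKeq : NK = ℓ * Nk := sitesPerDir_zero_eq_mul (F := F) h
  -- the residues of `x − x₀`
  set xr : Fin 3 → ℤ := fun i => (((x i - basePt F n K i).val : ℕ) : ℤ) with hxr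
  -- the candidate integers `t` per coordinate: `|ℓt − x̃_i| ≤ R`
  set T : Fin 3 → Finset ℤ := fun i => Finset.Icc ((xr i - R) / (ℓ : ℤ)) ((xr i + R) / (ℓ : ℤ)) with hT
  have hTcard : ∀ i, ((T i).card : ℝ) ≤ 4 * ((F.P K).L : ℝ) ^ 2 + 2 := by
    intro i
    rw [hT, Int.card_Icc]
    have hRℓ : R = 2 * ((F.P K).L : ℤ) ^ 2 * (ℓ : ℤ) := by rw [hR, hℓ]; push_cast; ring
    have h1 : (xr i + R) / (ℓ : ℤ) + 1 - (xr i - R) / (ℓ : ℤ) ≤ 4 * ((F.P K).L : ℤ) ^ 2 + 2 := by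
      have e : xr i + R = (xr i - R) + (4 * ((F.P K).L : ℤ) ^ 2) * (ℓ : ℤ) := by rw [hRℓ]; ring
      rw [e, Int.add_mul_ediv_right _ _ hℓz.ne']
      linarith
    have h2 : (((xr i + R) / (ℓ : ℤ) + 1 - (xr i - R) / (ℓ : ℤ)).toNat : ℝ) ≤ 4 * ((F.P K).L : ℝ) ^ 2 + 2 := by
      rcases le_or_gt 0 ((xr i + R) / (ℓ : ℤ) + 1 - (xr i - R) / (ℓ : ℤ)) with h0 | h0
      · have := Int.toNat_of_nonneg h0
        have h1' : ((((xr i + R) / (ℓ : ℤ) + 1 - (xr i - R) / (ℓ : ℤ)).toNat : ℤ) : ℝ) ≤ ((4 * ((F.P K).L : ℤ) ^ 2 + 2 : ℤ) : ℝ) := by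
          exact_mod_cast (this ▸ h1)
        push_cast at h1'
        exact_mod_cast h1'
      · rw [Int.toNat_of_nonpos h0.le]; norm_num; positivity
    exact h2
  -- the parametrisation of coarse bonds by (direction, integer triple)
  let Φ : Fin 3 × (Fin 3 → ℤ) → PBond (F.P n) 0 := fun p =>
    ⟨(siteShift (sites_eq F n K h)).symm (fun i => ((p.2 i : ℤ) : ZMod Nk)), p.1⟩
  -- every covering bond is a `Φ(μ, t)` with `t ∈ Π T i`
  have hcover : (Finset.univ.filter fun c : PBond (F.P n) 0 =>
        x ∈ (box (((ℓ : ℕ) : ℤ) • (fun i : Fin 3 => coordT3 F n K h c.src i)) R).image (fun z : Zd 3 => transl (basePt F n K) z))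
      ⊆ ((Finset.univ : Finset (Fin 3)) ×ˢ (Fintype.piFinset T)).image Φ := by
    intro c hc
    rw [Finset.mem_filter] at hc
    obtain ⟨z, hz, hzx⟩ := Finset.mem_image.mp hc.2
    rw [mem_box] at hz
    -- the integers `m_i` with `z_i = x̃_i + N_K m_i`, and `t_i = ŷ_i − N_k m_i`
    have hres : ∀ i, ((z i : ℤ) : ZMod NK) = ((xr i : ℤ) : ZMod NK) := by
      intro i
      have h1 : basePt F n K i + ((z i : ℤ) : ZMod NK) = x i := by
        have := congrFun hzx i
        rwa [transl_apply] at this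
      calc ((z i : ℤ) : ZMod NK) = x i - basePt F n K i := by rw [← h1]; abel
        _ = ((xr i : ℤ) : ZMod NK) := by rw [hxr]; push_cast; rw [ZMod.natCast_zmod_val]
    have hdvd : ∀ i, (NK : ℤ) ∣ z i - xr i := fun i => (ZMod.intCast_eq_intCast_iff_dvd_sub _ _ _).mp (hres i).symm
    choose m hm using hdvd
    refine Finset.mem_image.mpr ⟨(c.dir, fun i => coordT3 F n K h c.src i - (Nk : ℤ) * m i), ?_, ?_⟩
    · rw [Finset.mem_product]
      refine ⟨Finset.mem_univ _, Fintype.mem_piFinset.mpr fun i => ?_⟩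
      rw [hT, Finset.mem_Icc]
      have hzi := abs_le.mp (hz i)
      simp only [Pi.smul_apply, smul_eq_mul] at hzi
      have hmi := hm i
      have hNKz : (NK : ℤ) = (ℓ : ℤ) * (Nk : ℤ) := by rw [hNKeq]; push_cast; ring
      -- `ℓ t_i − x̃_i = ℓ ŷ_i − z_i`
      have key : (ℓ : ℤ) * (coordT3 F n K h c.src i - (Nk : ℤ) * m i) - xr i = (ℓ : ℤ) * coordT3 F n K h c.src i - z i := by
        have : z i = xr i + (NK : ℤ) * m i := by linarith
        rw [this, hNKz]; ring
      constructor
      · -- lower: (x̃ − R)/ℓ ≤ t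
        have : xr i - R ≤ (ℓ : ℤ) * (coordT3 F n K h c.src i - (Nk : ℤ) * m i) := by linarith
        calc (xr i - R) / (ℓ : ℤ) ≤ ((ℓ : ℤ) * (coordT3 F n K h c.src i - (Nk : ℤ) * m i)) / (ℓ : ℤ) := Int.ediv_le_ediv hℓz this
          _ = coordT3 F n K h c.src i - (Nk : ℤ) * m i := by rw [Int.mul_ediv_cancel_left _ hℓz.ne']
      · -- upper: t ≤ (x̃ + R)/ℓ
        have : (ℓ : ℤ) * (coordT3 F n K h c.src i - (Nk : ℤ) * m i) ≤ xr i + R := by linarith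
        calc coordT3 F n K h c.src i - (Nk : ℤ) * m i = ((ℓ : ℤ) * (coordT3 F n K h c.src i - (Nk : ℤ) * m i)) / (ℓ : ℤ) := by
              rw [Int.mul_ediv_cancel_left _ hℓz.ne']
          _ ≤ (xr i + R) / (ℓ : ℤ) := Int.ediv_le_ediv hℓz this
    · -- `Φ(dir, t) = c`
      simp only [Φ]
      have hsrc : (siteShift (sites_eq F n K h)).symm (fun i => (((coordT3 F n K h c.src i - (Nk : ℤ) * m i : ℤ)) : ZMod Nk)) = c.src := by
        rw [Equiv.symm_apply_eq]
        funext i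
        rw [coordT3_apply]
        push_cast
        rw [ZMod.natCast_self, zero_mul, sub_zero, ZMod.natCast_zmod_val]
      rw [hsrc]
  -- count
  have hcard := Finset.card_le_card hcover
  have himg := Finset.card_image_le (s := (Finset.univ : Finset (Fin 3)) ×ˢ (Fintype.piFinset T)) (f := Φ)
  have hprod : (((Finset.univ : Finset (Fin 3)) ×ˢ (Fintype.piFinset T)).card : ℝ) ≤ 3 * (4 * ((F.P K).L : ℝ) ^ 2 + 2) ^ 3 := by
    rw [Finset.card_product, Finset.card_univ, Fintype.card_fin, Fintype.card_piFinset]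
    push_cast
    rw [Fin.prod_univ_three]
    have h0 := hTcard 0; have h1 := hTcard 1; have h2 := hTcard 2
    have hn : ∀ i, (0 : ℝ) ≤ (T i).card := fun i => Nat.cast_nonneg _
    nlinarith [hn 0, hn 1, hn 2, mul_nonneg (hn 0) (hn 1), mul_le_mul h0 h1 (hn 1) (by positivity),
      mul_le_mul (mul_le_mul h0 h1 (hn 1) (by positivity)) h2 (hn 2) (by positivity)]
  have hfin : (((Finset.univ.filter fun c : PBond (F.P n) 0 =>
        x ∈ (box (((ℓ : ℕ) : ℤ) • (fun i : Fin 3 => coordT3 F n K h c.src i)) R).image (fun z : Zd 3 => transl (basePt F n K) z))).card : ℝ)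
      ≤ 3 * (4 * ((F.P K).L : ℝ) ^ 2 + 2) ^ 3 := by
    have := hcard.trans himg
    exact (Nat.cast_le.mpr this).trans hprod
  simpa only [hℓ, hR] using hfin

end Summit.QuantumFields.YangMills.Theorems.Prop7CornerFrameLegsFlatCountL2

end
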